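import Literature.AnabelianGeometry.EtaleTheta.Discharge.Sec3Thm37OfInputsCoset
import Literature.AnabelianGeometry.EtaleTheta.DivisorMonoidsConstants34
import HarnessLib

/-!
# [EtTh] Theorem 3.7 (i)–(iv) — END KNIT onto `DivisorMonoids.Prop34Const`, and the `Λ = ℚ` / `Λ = ℝ`
# END KNITS at the printed constant-field category `D^cnst = 𝓑(G_K)⁰` (proof-only)

S. Mochizuki, *The étale theta function and its Frobenioid-theoretic manifestations*, Publ. RIMS **45**
(2009) [EtTh], Thm. 3.7, PDF pp. 79–80; Prop. 3.4 (ii) p. 74 ("`L^× ⥲ F₀(Y^log)`", "`div₀(c) = v_L(c)·div(ϖ_L)`");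
the setting p. 72 (printed 298) "`D^cnst := B(Spec K)⁰`" [cite: MochizukiEtTh2009, Thm 3.7 p.79]
[cite: MochizukiEtTh2009, Prop 3.4 (ii) p.74].  abc-iut cell, layer L2, node EtTh:Thm3.7 «END KNIT»
(sequel of `Sec3Thm37OfInputsCoset.lean` p429839, same seat abc-iut-w5-d164; abc-iut-L2-lead gen 3 R206/R211:
consumers re-knit BY NAME onto abc-iut-L2-t3's predicate bundle `DivisorMonoids.Prop34Const`, p434595).

WHAT IS NEW.
* §1 `Λ = ℤ`: `thm37_ofRlfZ_of_inputs_of_prop34Const` — the third END-KNIT form with its `B₀`-level binder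
  `hcyc` ("the divisors of the constants are the integer powers of one log-divisor") supplied BY NAME by
  `Prop34Const.hcyc`; residual list {`hBmon`, `hP34`, `hD`, `hnd`, `hrat`, `h34 : dm.Prop34`,
  `h₀ : dm.Prop34Cnst₀ cnst`, `hC : dm.Prop34Const`} — every item a NAMED property of the Def. 3.3 (iii) data of
  genuine tempered coverings (Prop. 3.4 (i)/(ii) and its constant-field clauses), a print hypothesis, or the
  [FrdI] Thm. 5.2 preamble.
* §2 `Λ = ℚ` (`ofRlfQ dm hpf`; `B₀^ℚ = B₀^pf`, `F₀^ℚ = F₀^pf`): `thm37_ofRlfQ_of_inputs_of_cosetCnst` — Thm. 3.7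
  (i)(ii)(iii) with `D^cnst = 𝓑(G)⁰` (`CosetCat G`, `G` compact), the Aut-invariance input `hKfix` of the gen-3 knit
  `thm37_ofRlfQ_of_inputs` (p429227) now DERIVED: `hLine` ⟸ `hcyc` (abc-iut-w4-d008 `ofRlfQ_line`), `hInt` ⟸
  `IsPerfFactorial.Rlf.isCancelMul`, `hfin` ⟸ `CosetCat.isOfFinOrder_aut` (abc-iut-w5-d250), through
  `thm37_of_inputs_of_cnst` (p429404); residual {`hBmon`, `hD`, `hnd`, `hrat`, `h34`, `h₀`, `hQ`, `hcyc`} and the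
  `_of_prop34Const` form {…, `hQ`, `hC : dm.Prop34Const`}.
* §3 `Λ = ℝ` (`ofRlfR dm hpf`; `B₀^ℝ = ℝ·Φ₀^birat`, `F₀^ℝ = ℝ·Φ₀^cnst`): `thm37_ofRlfR_of_inputs_of_cosetCnst` (clause 1
  of Prop. 3.4 (ii) at `Λ = ℝ` as the binder `hE`, GAP G-w5d130-1) and `thm37_ofRlfR_fin_of_inputs_of_cosetCnst`
  (print's finiteness setting, `hE` a THEOREM — abc-iut-w5-d130 `Prop34Cnst.ofRlfR_of_finite_intPrimes`), each with
  `hKfix` DERIVED as in §2 (`ofRlfR_line`), plus the `_of_prop34Const` forms.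
No definitions; nothing here bears on [IUTchIII] Cor. 3.12; typed ≠ proved.
-/

namespace Literature.AnabelianGeometry.EtaleTheta

open CategoryTheory Opposite Literature.AlgebraicGeometry.Frobenioids Literature.AnabelianGeometry.SemiGraphs

namespace TemperedFrobenioid

universe u₀ v₀ u₁ u v w uK

/-! ### §1 `Λ = ℤ`: the third END-KNIT form onto `Prop34Const` -/

section OfRlfZ

variable {D₀ : Type u₀} [Category.{v₀} D₀] {dm : DivisorMonoids.{u₀, v₀, w} D₀}
  {hpf : ∀ Y : D₀ᵒᵖ, IsPerfFactorial (dm.Φ₀.obj Y)} {V : FrdIMonoidStub.{w}} {V₀ : FrdICatStub.{u₀, v₀, w} D₀}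
  {D : Type u} [Category.{v} D] {IsRational IsStrictlyRational : (Dᵒᵖ ⥤ CommMonCat.{w}) → Prop}
  (C₀ : TemperedFrobenioid (RealifiedDivisorMonoids.ofRlfZ dm hpf) D (treeCatVocab D IsRational IsStrictlyRational))
  {GK : Type u₁} [Group GK] [TopologicalSpace GK] [SeparatelyContinuousMul GK] [CompactSpace GK]
  {cnst : D₀ ⥤ CosetCat GK} (p : ℕ) [Fact p.Prime]

/-- **[EtTh] Theorem 3.7 (i)–(iv) for `Λ = ℤ` data with `D^cnst = 𝓑(G)⁰` (`G` compact), knit onto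
`DivisorMonoids.Prop34Const`** — residual binders {`hBmon`, `hP34`, `hD`, `hnd`, `hrat`, `h34`, `h₀`, `hC`}:
(i) unit-profinite / isotropic / model / birationally Frobenius-normalized / sub-quasi-Frobenius-trivial / not
group-like; (ii) standard ∧ rationally standard (THE [FrdI] Def. 4.5 parameters); (iii) both clauses over
`(D → D₀) ⋙ cnst`; (iv).  The `B₀`-level input `hcyc` of `thm37_ofRlfZ_of_inputs_of_cosetCnst` is
`DivisorMonoids.Prop34Const.hcyc hC` (Prop. 3.4 (ii): `div₀(c) = v_L(c)·div(ϖ_L)`).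
[cite: MochizukiEtTh2009, Thm 3.7 p.79] -/
theorem thm37_ofRlfZ_of_inputs_of_prop34Const (hBmon : IsMonoidOn C₀.ratFnFunctor)
    (hP34 : ∀ A : Dᵒᵖ, ∃ L : PadicFrd.PadicFld.{uK} p, L.IsPadicLocal ∧
      Nonempty ((((RealifiedDivisorMonoids.ofRlfZ dm hpf).divΛ (C₀.baseOp A)).comp
        (Units.coeHom ((RealifiedDivisorMonoids.ofRlfZ dm hpf).BΛ.obj (C₀.baseOp A)))).ker ≃*
        PadicFrd.unitSubgroup L.K))
    (hD : IsOfFSMFFType D) (hnd : IsNonDilatingOn C₀.divisorMonoid)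
    (hrat : ∀ X : C₀.category,
      PreFrobenioidData.IsRational
        (PreFrobenioid.biratData (C₀.isFrobenioid_treeCatVocab_of_isMonoidOn hBmon)
          (PreFrobenioid.hasBiratSquares_of_isFrobenioid (C₀.isFrobenioid_treeCatVocab_of_isMonoidOn hBmon)))
        (S := PreFrobenioidData.ofFunctor C₀.divisorMonoid C₀.toElem) (fun a 𝔭 => PrimarySupp a 𝔭) X)
    (h34 : dm.Prop34 V V₀) (h₀ : dm.Prop34Cnst₀ cnst) (hC : dm.Prop34Const) :
    (PreFrobenioid.IsOfUnitProfiniteType C₀.toElem ∧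
      PreFrobenioid.IsOfIsotropicType C₀.toElem ∧
      PreFrobenioid.IsOfModelType C₀.toElem (C₀.isFrobenioid_treeCatVocab_of_isMonoidOn hBmon)
        (PreFrobenioid.hasBiratSquares_of_isFrobenioid (C₀.isFrobenioid_treeCatVocab_of_isMonoidOn hBmon)) ∧
      PreFrobenioidData.IsOfBiratFrobeniusNormalizedType
        (PreFrobenioid.biratData (C₀.isFrobenioid_treeCatVocab_of_isMonoidOn hBmon)
          (PreFrobenioid.hasBiratSquares_of_isFrobenioid (C₀.isFrobenioid_treeCatVocab_of_isMonoidOn hBmon))) ∧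
      PreFrobenioid.IsOfType (PreFrobenioid.IsSubQuasiFrobeniusTrivial C₀.toElem) ∧
      ¬ PreFrobenioid.IsOfType (PreFrobenioid.IsGroupLikeObj C₀.toElem)) ∧
    ((ModelFrobenioid.data C₀.divisorMonoid C₀.ratFnFunctor C₀.divBNatTrans).IsOfStandardType ∧
      (PreFrobenioidData.ofFunctor C₀.divisorMonoid C₀.toElem).IsOfRationallyStandardType
        (PreFrobenioid.rsParams (C₀.isFrobenioid_treeCatVocab_of_isMonoidOn hBmon) fun a 𝔭 => PrimarySupp a 𝔭)) ∧
    ((∀ A : C₀.category,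
        FrobenioidFacade.AutActionFactorsThrough (C₀.base ⋙ cnst) C₀.toElem A) ∧
      (∀ A : C₀.category, FrobenioidFacade.AutActionFaithful (C₀.base ⋙ cnst) C₀.toElem A)) ∧
    C₀.Thm37_iv :=
  C₀.thm37_ofRlfZ_of_inputs_of_cosetCnst p hBmon hP34 hD hnd hrat h34 h₀ hC.hcyc

end OfRlfZ

/-! ### §2 `Λ = ℚ`: the constructed data `ofRlfQ dm hpf` with `D^cnst = 𝓑(G)⁰` -/

section OfRlfQ

variable {D₀ : Type u₀} [Category.{v₀} D₀] {dm : DivisorMonoids.{u₀, v₀, w} D₀}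
  {hpf : ∀ Y : D₀ᵒᵖ, IsPerfFactorial (dm.Φ₀.obj Y)} {V : FrdIMonoidStub.{w}} {V₀ : FrdICatStub.{u₀, v₀, w} D₀}
  {D : Type u} [Category.{v} D] {IsRational IsStrictlyRational : (Dᵒᵖ ⥤ CommMonCat.{w}) → Prop}
  (C₀ : TemperedFrobenioid (RealifiedDivisorMonoids.ofRlfQ dm hpf) D (treeCatVocab D IsRational IsStrictlyRational))
  {GK : Type u₁} [Group GK] [TopologicalSpace GK] [SeparatelyContinuousMul GK] [CompactSpace GK]
  {cnst : D₀ ⥤ CosetCat GK}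

/-- **[EtTh] Theorem 3.7 (i)–(iii) for a tempered Frobenioid of monoid type `ℚ` over the CONSTRUCTED data
`ofRlfQ dm hpf`, with `D^cnst = 𝓑(G)⁰` (`G` compact, e.g. `G_K`)** — the Aut-invariance input `hKfix`
("`Π^tp_X` acts trivially on `K^×/O_K^×`") of `thm37_ofRlfQ_of_inputs` now DERIVED (`hLine` ⟸ `hcyc` by
`ofRlfQ_line`, `hInt` ⟸ `IsPerfFactorial.Rlf.isCancelMul`, `hfin` ⟸ `CosetCat.isOfFinOrder_aut`): residual binders
{`hBmon`, `hD`, `hnd`, `hrat`, `h34 : dm.Prop34`, `h₀ : dm.Prop34Cnst₀ cnst`, `hQ` (automorphisms agreeing on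
`Ker(div₀)` up to torsion have the same image under `cnst`, GAP G-w4d084-2), `hcyc` (Prop. 3.4 (ii):
`div₀(c) = v_L(c)·div(ϖ_L)`)}.  (i): isotropic / model / birationally Frobenius-normalized /
sub-quasi-Frobenius-trivial / not group-like (both unit conjuncts are restricted by print to `ℤ`/`ℝ`); (ii) standard
∧ rationally standard; (iii) both clauses (`Λ ∈ {ℤ, ℚ}`). [cite: MochizukiEtTh2009, Thm 3.7 p.79] -/
theorem thm37_ofRlfQ_of_inputs_of_cosetCnst (hBmon : IsMonoidOn C₀.ratFnFunctor)
    (hD : IsOfFSMFFType D) (hnd : IsNonDilatingOn C₀.divisorMonoid)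
    (hrat : ∀ X : C₀.category,
      PreFrobenioidData.IsRational
        (PreFrobenioid.biratData (C₀.isFrobenioid_treeCatVocab_of_isMonoidOn hBmon)
          (PreFrobenioid.hasBiratSquares_of_isFrobenioid (C₀.isFrobenioid_treeCatVocab_of_isMonoidOn hBmon)))
        (S := PreFrobenioidData.ofFunctor C₀.divisorMonoid C₀.toElem) (fun a 𝔭 => PrimarySupp a 𝔭) X)
    (h34 : dm.Prop34 V V₀) (h₀ : dm.Prop34Cnst₀ cnst)
    (hQ : ∀ {Y : D₀} (g g' : Y ≅ Y),
      (∀ b : dm.B₀.obj (op Y), dm.div₀ (op Y) b = 1 →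
        ∃ N : ℕ+, ((dm.B₀.map g.hom.op).hom b) ^ (N : ℕ) = ((dm.B₀.map g'.hom.op).hom b) ^ (N : ℕ)) →
      cnst.map g.hom = cnst.map g'.hom)
    (hcyc : ∀ Y : D₀ᵒᵖ, ∃ d : dm.Φ₀.obj Y, ∀ b ∈ dm.F₀ Y, ∃ n : ℤ,
      dm.div₀ Y b = Algebra.GrothendieckGroup.of d ^ n) :
    (PreFrobenioid.IsOfIsotropicType C₀.toElem ∧
      PreFrobenioid.IsOfModelType C₀.toElem (C₀.isFrobenioid_treeCatVocab_of_isMonoidOn hBmon)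
        (PreFrobenioid.hasBiratSquares_of_isFrobenioid (C₀.isFrobenioid_treeCatVocab_of_isMonoidOn hBmon)) ∧
      PreFrobenioidData.IsOfBiratFrobeniusNormalizedType
        (PreFrobenioid.biratData (C₀.isFrobenioid_treeCatVocab_of_isMonoidOn hBmon)
          (PreFrobenioid.hasBiratSquares_of_isFrobenioid (C₀.isFrobenioid_treeCatVocab_of_isMonoidOn hBmon))) ∧
      PreFrobenioid.IsOfType (PreFrobenioid.IsSubQuasiFrobeniusTrivial C₀.toElem) ∧
      ¬ PreFrobenioid.IsOfType (PreFrobenioid.IsGroupLikeObj C₀.toElem)) ∧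
    ((ModelFrobenioid.data C₀.divisorMonoid C₀.ratFnFunctor C₀.divBNatTrans).IsOfStandardType ∧
      (PreFrobenioidData.ofFunctor C₀.divisorMonoid C₀.toElem).IsOfRationallyStandardType
        (PreFrobenioid.rsParams (C₀.isFrobenioid_treeCatVocab_of_isMonoidOn hBmon) fun a 𝔭 => PrimarySupp a 𝔭)) ∧
    ((∀ A : C₀.category,
        FrobenioidFacade.AutActionFactorsThrough (C₀.base ⋙ cnst) C₀.toElem A) ∧
      (∀ A : C₀.category, FrobenioidFacade.AutActionFaithful (C₀.base ⋙ cnst) C₀.toElem A)) := by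
  have hQΛ : C₀.monoidType = MonoidType.Q := rfl
  obtain ⟨⟨-, -, hi3, hi4, hi5, hi6, hi7⟩, hii, ⟨hiii1, hiii2⟩, -⟩ :=
    thm37_of_inputs_of_cnst.{u₀, v₀, u₁, u₁, u, v, w, 0} C₀ 2 hBmon
      (fun hZ => absurd (hQΛ.symm.trans hZ) (by decide))
      (fun hR => absurd (hQΛ.symm.trans hR) (by decide)) hD hnd hrat
      (RealifiedDivisorMonoids.Prop34Cnst.ofRlfQ h34 h₀ hQ)
      (RealifiedDivisorMonoids.ofRlfQ_line dm hpf hcyc)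
      (fun Y => IsPerfFactorial.Rlf.isCancelMul (hpf Y)) fun Z φ => CosetCat.isOfFinOrder_aut Z φ
  exact ⟨⟨hi3, hi4, hi5, hi6, hi7⟩, hii, ⟨hiii1, hiii2 (Or.inr hQΛ)⟩⟩

/-- **The same, knit onto `DivisorMonoids.Prop34Const`**: `hcyc := Prop34Const.hcyc hC`; residual binders
{`hBmon`, `hD`, `hnd`, `hrat`, `h34`, `h₀`, `hQ`, `hC : dm.Prop34Const`}. [cite: MochizukiEtTh2009, Thm 3.7 p.79] -/
theorem thm37_ofRlfQ_of_inputs_of_prop34Const (hBmon : IsMonoidOn C₀.ratFnFunctor)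
    (hD : IsOfFSMFFType D) (hnd : IsNonDilatingOn C₀.divisorMonoid)
    (hrat : ∀ X : C₀.category,
      PreFrobenioidData.IsRational
        (PreFrobenioid.biratData (C₀.isFrobenioid_treeCatVocab_of_isMonoidOn hBmon)
          (PreFrobenioid.hasBiratSquares_of_isFrobenioid (C₀.isFrobenioid_treeCatVocab_of_isMonoidOn hBmon)))
        (S := PreFrobenioidData.ofFunctor C₀.divisorMonoid C₀.toElem) (fun a 𝔭 => PrimarySupp a 𝔭) X)
    (h34 : dm.Prop34 V V₀) (h₀ : dm.Prop34Cnst₀ cnst)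
    (hQ : ∀ {Y : D₀} (g g' : Y ≅ Y),
      (∀ b : dm.B₀.obj (op Y), dm.div₀ (op Y) b = 1 →
        ∃ N : ℕ+, ((dm.B₀.map g.hom.op).hom b) ^ (N : ℕ) = ((dm.B₀.map g'.hom.op).hom b) ^ (N : ℕ)) →
      cnst.map g.hom = cnst.map g'.hom)
    (hC : dm.Prop34Const) :
    (PreFrobenioid.IsOfIsotropicType C₀.toElem ∧
      PreFrobenioid.IsOfModelType C₀.toElem (C₀.isFrobenioid_treeCatVocab_of_isMonoidOn hBmon)
        (PreFrobenioid.hasBiratSquares_of_isFrobenioid (C₀.isFrobenioid_treeCatVocab_of_isMonoidOn hBmon)) ∧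
      PreFrobenioidData.IsOfBiratFrobeniusNormalizedType
        (PreFrobenioid.biratData (C₀.isFrobenioid_treeCatVocab_of_isMonoidOn hBmon)
          (PreFrobenioid.hasBiratSquares_of_isFrobenioid (C₀.isFrobenioid_treeCatVocab_of_isMonoidOn hBmon))) ∧
      PreFrobenioid.IsOfType (PreFrobenioid.IsSubQuasiFrobeniusTrivial C₀.toElem) ∧
      ¬ PreFrobenioid.IsOfType (PreFrobenioid.IsGroupLikeObj C₀.toElem)) ∧
    ((ModelFrobenioid.data C₀.divisorMonoid C₀.ratFnFunctor C₀.divBNatTrans).IsOfStandardType ∧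
      (PreFrobenioidData.ofFunctor C₀.divisorMonoid C₀.toElem).IsOfRationallyStandardType
        (PreFrobenioid.rsParams (C₀.isFrobenioid_treeCatVocab_of_isMonoidOn hBmon) fun a 𝔭 => PrimarySupp a 𝔭)) ∧
    ((∀ A : C₀.category,
        FrobenioidFacade.AutActionFactorsThrough (C₀.base ⋙ cnst) C₀.toElem A) ∧
      (∀ A : C₀.category, FrobenioidFacade.AutActionFaithful (C₀.base ⋙ cnst) C₀.toElem A)) :=
  C₀.thm37_ofRlfQ_of_inputs_of_cosetCnst hBmon hD hnd hrat h34 h₀ hQ hC.hcyc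

end OfRlfQ

/-! ### §3 `Λ = ℝ`: the constructed data `ofRlfR dm hpf` with `D^cnst = 𝓑(G)⁰` -/

section OfRlfR

variable {D₀ : Type u₀} [Category.{v₀} D₀] {dm : DivisorMonoids.{u₀, v₀, w} D₀}
  {hpf : ∀ Y : D₀ᵒᵖ, IsPerfFactorial (dm.Φ₀.obj Y)} {V : FrdIMonoidStub.{w}} {V₀ : FrdICatStub.{u₀, v₀, w} D₀}
  {D : Type u} [Category.{v} D] {IsRational IsStrictlyRational : (Dᵒᵖ ⥤ CommMonCat.{w}) → Prop}
  (C₀ : TemperedFrobenioid (RealifiedDivisorMonoids.ofRlfR dm hpf) D (treeCatVocab D IsRational IsStrictlyRational))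
  {GK : Type u₁} [Group GK] [TopologicalSpace GK] [SeparatelyContinuousMul GK] [CompactSpace GK]
  {cnst : D₀ ⥤ CosetCat GK}

/-- **[EtTh] Theorem 3.7 (i)–(iv) for a tempered Frobenioid of monoid type `ℝ` over the CONSTRUCTED data
`ofRlfR dm hpf`, with `D^cnst = 𝓑(G)⁰` (`G` compact)** — `hKfix` DERIVED (`ofRlfR_line` + `Rlf.isCancelMul` +
`CosetCat.isOfFinOrder_aut`): residual binders {`hBmon`, `hD`, `hnd`, `hrat`, `h₀ : dm.Prop34Cnst₀ cnst`, `hE`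
(clause 1 of Prop. 3.4 (ii) at `Λ = ℝ`: "effective elements of `ℝ·Φ₀^birat` are constant", GAP G-w5d130-1),
`hcyc`}.  Unit-TRIVIAL type outright; (iii) first clause; (iv). [cite: MochizukiEtTh2009, Thm 3.7 p.79] -/
theorem thm37_ofRlfR_of_inputs_of_cosetCnst (hBmon : IsMonoidOn C₀.ratFnFunctor)
    (hD : IsOfFSMFFType D) (hnd : IsNonDilatingOn C₀.divisorMonoid)
    (hrat : ∀ X : C₀.category,
      PreFrobenioidData.IsRational
        (PreFrobenioid.biratData (C₀.isFrobenioid_treeCatVocab_of_isMonoidOn hBmon)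
          (PreFrobenioid.hasBiratSquares_of_isFrobenioid (C₀.isFrobenioid_treeCatVocab_of_isMonoidOn hBmon)))
        (S := PreFrobenioidData.ofFunctor C₀.divisorMonoid C₀.toElem) (fun a 𝔭 => PrimarySupp a 𝔭) X)
    (h₀ : dm.Prop34Cnst₀ cnst)
    (hE : ∀ (Y : D₀) (b : Algebra.GrothendieckGroup ((RealifiedDivisorMonoids.realData dm hpf).rlf.obj (op Y)))
      (x : (hpf (op Y)).Rlf),
      b ∈ ((RealifiedDivisorMonoids.realData dm hpf).realSpan dm.biratGp).carrier Y →
        b = Algebra.GrothendieckGroup.of x →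
        b ∈ ((RealifiedDivisorMonoids.realData dm hpf).realSpan dm.cnstGp).carrier Y)
    (hcyc : ∀ Y : D₀ᵒᵖ, ∃ d : dm.Φ₀.obj Y, ∀ b ∈ dm.F₀ Y, ∃ n : ℤ,
      dm.div₀ Y b = Algebra.GrothendieckGroup.of d ^ n) :
    (PreFrobenioid.IsOfType (PreFrobenioid.IsUnitTrivial C₀.toElem) ∧
      PreFrobenioid.IsOfIsotropicType C₀.toElem ∧
      PreFrobenioid.IsOfModelType C₀.toElem (C₀.isFrobenioid_treeCatVocab_of_isMonoidOn hBmon)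
        (PreFrobenioid.hasBiratSquares_of_isFrobenioid (C₀.isFrobenioid_treeCatVocab_of_isMonoidOn hBmon)) ∧
      PreFrobenioidData.IsOfBiratFrobeniusNormalizedType
        (PreFrobenioid.biratData (C₀.isFrobenioid_treeCatVocab_of_isMonoidOn hBmon)
          (PreFrobenioid.hasBiratSquares_of_isFrobenioid (C₀.isFrobenioid_treeCatVocab_of_isMonoidOn hBmon))) ∧
      PreFrobenioid.IsOfType (PreFrobenioid.IsSubQuasiFrobeniusTrivial C₀.toElem) ∧
      ¬ PreFrobenioid.IsOfType (PreFrobenioid.IsGroupLikeObj C₀.toElem)) ∧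
    ((ModelFrobenioid.data C₀.divisorMonoid C₀.ratFnFunctor C₀.divBNatTrans).IsOfStandardType ∧
      (PreFrobenioidData.ofFunctor C₀.divisorMonoid C₀.toElem).IsOfRationallyStandardType
        (PreFrobenioid.rsParams (C₀.isFrobenioid_treeCatVocab_of_isMonoidOn hBmon) fun a 𝔭 => PrimarySupp a 𝔭)) ∧
    (∀ A : C₀.category, FrobenioidFacade.AutActionFactorsThrough (C₀.base ⋙ cnst) C₀.toElem A) ∧
    C₀.Thm37_iv := by
  have hR : C₀.monoidType = MonoidType.R := rfl
  obtain ⟨⟨-, hi2, hi3, hi4, hi5, hi6, hi7⟩, hii, ⟨hiii1, -⟩, hiv⟩ :=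
    thm37_of_inputs_of_cnst.{u₀, v₀, u₁, u₁, u, v, w, 0} C₀ 2 hBmon
      (fun hZ => absurd (hR.symm.trans hZ) (by decide))
      (fun _ A => RealifiedDivisorMonoids.ofRlfR_divΛ_injective dm hpf (C₀.baseOp A)) hD hnd hrat
      (RealifiedDivisorMonoids.Prop34Cnst.ofRlfR_of_eff h₀ hE)
      (RealifiedDivisorMonoids.ofRlfR_line dm hpf hcyc)
      (fun Y => IsPerfFactorial.Rlf.isCancelMul (hpf Y)) fun Z φ => CosetCat.isOfFinOrder_aut Z φ
  exact ⟨⟨hi2 hR, hi3, hi4, hi5, hi6, hi7⟩, hii, hiii1, hiv⟩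

/-- **The same, knit onto `DivisorMonoids.Prop34Const`** (`hcyc := Prop34Const.hcyc hC`): residual binders
{`hBmon`, `hD`, `hnd`, `hrat`, `h₀`, `hE`, `hC : dm.Prop34Const`}. [cite: MochizukiEtTh2009, Thm 3.7 p.79] -/
theorem thm37_ofRlfR_of_inputs_of_prop34Const (hBmon : IsMonoidOn C₀.ratFnFunctor)
    (hD : IsOfFSMFFType D) (hnd : IsNonDilatingOn C₀.divisorMonoid)
    (hrat : ∀ X : C₀.category,
      PreFrobenioidData.IsRational
        (PreFrobenioid.biratData (C₀.isFrobenioid_treeCatVocab_of_isMonoidOn hBmon)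
          (PreFrobenioid.hasBiratSquares_of_isFrobenioid (C₀.isFrobenioid_treeCatVocab_of_isMonoidOn hBmon)))
        (S := PreFrobenioidData.ofFunctor C₀.divisorMonoid C₀.toElem) (fun a 𝔭 => PrimarySupp a 𝔭) X)
    (h₀ : dm.Prop34Cnst₀ cnst)
    (hE : ∀ (Y : D₀) (b : Algebra.GrothendieckGroup ((RealifiedDivisorMonoids.realData dm hpf).rlf.obj (op Y)))
      (x : (hpf (op Y)).Rlf),
      b ∈ ((RealifiedDivisorMonoids.realData dm hpf).realSpan dm.biratGp).carrier Y →
        b = Algebra.GrothendieckGroup.of x →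
        b ∈ ((RealifiedDivisorMonoids.realData dm hpf).realSpan dm.cnstGp).carrier Y)
    (hC : dm.Prop34Const) :
    (PreFrobenioid.IsOfType (PreFrobenioid.IsUnitTrivial C₀.toElem) ∧
      PreFrobenioid.IsOfIsotropicType C₀.toElem ∧
      PreFrobenioid.IsOfModelType C₀.toElem (C₀.isFrobenioid_treeCatVocab_of_isMonoidOn hBmon)
        (PreFrobenioid.hasBiratSquares_of_isFrobenioid (C₀.isFrobenioid_treeCatVocab_of_isMonoidOn hBmon)) ∧
      PreFrobenioidData.IsOfBiratFrobeniusNormalizedType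
        (PreFrobenioid.biratData (C₀.isFrobenioid_treeCatVocab_of_isMonoidOn hBmon)
          (PreFrobenioid.hasBiratSquares_of_isFrobenioid (C₀.isFrobenioid_treeCatVocab_of_isMonoidOn hBmon))) ∧
      PreFrobenioid.IsOfType (PreFrobenioid.IsSubQuasiFrobeniusTrivial C₀.toElem) ∧
      ¬ PreFrobenioid.IsOfType (PreFrobenioid.IsGroupLikeObj C₀.toElem)) ∧
    ((ModelFrobenioid.data C₀.divisorMonoid C₀.ratFnFunctor C₀.divBNatTrans).IsOfStandardType ∧
      (PreFrobenioidData.ofFunctor C₀.divisorMonoid C₀.toElem).IsOfRationallyStandardType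
        (PreFrobenioid.rsParams (C₀.isFrobenioid_treeCatVocab_of_isMonoidOn hBmon) fun a 𝔭 => PrimarySupp a 𝔭)) ∧
    (∀ A : C₀.category, FrobenioidFacade.AutActionFactorsThrough (C₀.base ⋙ cnst) C₀.toElem A) ∧
    C₀.Thm37_iv :=
  C₀.thm37_ofRlfR_of_inputs_of_cosetCnst hBmon hD hnd hrat h₀ hE hC.hcyc

/-- **Print's setting for the `Λ = ℝ` clause 1** ("finitely many primes of each `Φ₀(Y)`, each `Φ₀(Y)_𝔭 ≅ ℤ_{≥0}` or
`ℚ_{≥0}`" — genuine divisor monoids of tempered coverings): `hE` is a THEOREM of `dm.Prop34` (abc-iut-w5-d130,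
`Prop34Cnst.ofRlfR_of_finite_intPrimes`) and `hKfix` is DERIVED as above, so at `D^cnst = 𝓑(G)⁰` the residual list is
{`hBmon`, `hD`, `hnd`, `hrat`, `h34`, `h₀`, `hfin`, `hZQ`, `hcyc`}. [cite: MochizukiEtTh2009, Thm 3.7 p.79] -/
theorem thm37_ofRlfR_fin_of_inputs_of_cosetCnst (hBmon : IsMonoidOn C₀.ratFnFunctor)
    (hD : IsOfFSMFFType D) (hnd : IsNonDilatingOn C₀.divisorMonoid)
    (hrat : ∀ X : C₀.category,
      PreFrobenioidData.IsRational
        (PreFrobenioid.biratData (C₀.isFrobenioid_treeCatVocab_of_isMonoidOn hBmon)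
          (PreFrobenioid.hasBiratSquares_of_isFrobenioid (C₀.isFrobenioid_treeCatVocab_of_isMonoidOn hBmon)))
        (S := PreFrobenioidData.ofFunctor C₀.divisorMonoid C₀.toElem) (fun a 𝔭 => PrimarySupp a 𝔭) X)
    (h34 : dm.Prop34 V V₀) (h₀ : dm.Prop34Cnst₀ cnst)
    (hfin : ∀ Y : D₀, Finite (Primes (dm.Φ₀.obj (op Y))))
    (hZQ : ∀ (Y : D₀) (𝔭 : Primes (dm.Φ₀.obj (op Y))), IsZMonoprime ↥𝔭.submonoid ∨ IsQMonoprime ↥𝔭.submonoid)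
    (hcyc : ∀ Y : D₀ᵒᵖ, ∃ d : dm.Φ₀.obj Y, ∀ b ∈ dm.F₀ Y, ∃ n : ℤ,
      dm.div₀ Y b = Algebra.GrothendieckGroup.of d ^ n) :
    (PreFrobenioid.IsOfType (PreFrobenioid.IsUnitTrivial C₀.toElem) ∧
      PreFrobenioid.IsOfIsotropicType C₀.toElem ∧
      PreFrobenioid.IsOfModelType C₀.toElem (C₀.isFrobenioid_treeCatVocab_of_isMonoidOn hBmon)
        (PreFrobenioid.hasBiratSquares_of_isFrobenioid (C₀.isFrobenioid_treeCatVocab_of_isMonoidOn hBmon)) ∧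
      PreFrobenioidData.IsOfBiratFrobeniusNormalizedType
        (PreFrobenioid.biratData (C₀.isFrobenioid_treeCatVocab_of_isMonoidOn hBmon)
          (PreFrobenioid.hasBiratSquares_of_isFrobenioid (C₀.isFrobenioid_treeCatVocab_of_isMonoidOn hBmon))) ∧
      PreFrobenioid.IsOfType (PreFrobenioid.IsSubQuasiFrobeniusTrivial C₀.toElem) ∧
      ¬ PreFrobenioid.IsOfType (PreFrobenioid.IsGroupLikeObj C₀.toElem)) ∧
    ((ModelFrobenioid.data C₀.divisorMonoid C₀.ratFnFunctor C₀.divBNatTrans).IsOfStandardType ∧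
      (PreFrobenioidData.ofFunctor C₀.divisorMonoid C₀.toElem).IsOfRationallyStandardType
        (PreFrobenioid.rsParams (C₀.isFrobenioid_treeCatVocab_of_isMonoidOn hBmon) fun a 𝔭 => PrimarySupp a 𝔭)) ∧
    (∀ A : C₀.category, FrobenioidFacade.AutActionFactorsThrough (C₀.base ⋙ cnst) C₀.toElem A) ∧
    C₀.Thm37_iv := by
  have hR : C₀.monoidType = MonoidType.R := rfl
  obtain ⟨⟨-, hi2, hi3, hi4, hi5, hi6, hi7⟩, hii, ⟨hiii1, -⟩, hiv⟩ :=
    thm37_of_inputs_of_cnst.{u₀, v₀, u₁, u₁, u, v, w, 0} C₀ 2 hBmon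
      (fun hZ => absurd (hR.symm.trans hZ) (by decide))
      (fun _ A => RealifiedDivisorMonoids.ofRlfR_divΛ_injective dm hpf (C₀.baseOp A)) hD hnd hrat
      (RealifiedDivisorMonoids.Prop34Cnst.ofRlfR_of_finite_intPrimes h34 h₀ hfin hZQ)
      (RealifiedDivisorMonoids.ofRlfR_line dm hpf hcyc)
      (fun Y => IsPerfFactorial.Rlf.isCancelMul (hpf Y)) fun Z φ => CosetCat.isOfFinOrder_aut Z φ
  exact ⟨⟨hi2 hR, hi3, hi4, hi5, hi6, hi7⟩, hii, hiii1, hiv⟩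

/-- **Print's finiteness setting, knit onto `DivisorMonoids.Prop34Const`**: residual binders
{`hBmon`, `hD`, `hnd`, `hrat`, `h34`, `h₀`, `hfin`, `hZQ`, `hC : dm.Prop34Const`}. [cite: MochizukiEtTh2009, Thm 3.7 p.79] -/
theorem thm37_ofRlfR_fin_of_inputs_of_prop34Const (hBmon : IsMonoidOn C₀.ratFnFunctor)
    (hD : IsOfFSMFFType D) (hnd : IsNonDilatingOn C₀.divisorMonoid)
    (hrat : ∀ X : C₀.category,
      PreFrobenioidData.IsRational
        (PreFrobenioid.biratData (C₀.isFrobenioid_treeCatVocab_of_isMonoidOn hBmon)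
          (PreFrobenioid.hasBiratSquares_of_isFrobenioid (C₀.isFrobenioid_treeCatVocab_of_isMonoidOn hBmon)))
        (S := PreFrobenioidData.ofFunctor C₀.divisorMonoid C₀.toElem) (fun a 𝔭 => PrimarySupp a 𝔭) X)
    (h34 : dm.Prop34 V V₀) (h₀ : dm.Prop34Cnst₀ cnst)
    (hfin : ∀ Y : D₀, Finite (Primes (dm.Φ₀.obj (op Y))))
    (hZQ : ∀ (Y : D₀) (𝔭 : Primes (dm.Φ₀.obj (op Y))), IsZMonoprime ↥𝔭.submonoid ∨ IsQMonoprime ↥𝔭.submonoid)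
    (hC : dm.Prop34Const) :
    (PreFrobenioid.IsOfType (PreFrobenioid.IsUnitTrivial C₀.toElem) ∧
      PreFrobenioid.IsOfIsotropicType C₀.toElem ∧
      PreFrobenioid.IsOfModelType C₀.toElem (C₀.isFrobenioid_treeCatVocab_of_isMonoidOn hBmon)
        (PreFrobenioid.hasBiratSquares_of_isFrobenioid (C₀.isFrobenioid_treeCatVocab_of_isMonoidOn hBmon)) ∧
      PreFrobenioidData.IsOfBiratFrobeniusNormalizedType
        (PreFrobenioid.biratData (C₀.isFrobenioid_treeCatVocab_of_isMonoidOn hBmon)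
          (PreFrobenioid.hasBiratSquares_of_isFrobenioid (C₀.isFrobenioid_treeCatVocab_of_isMonoidOn hBmon))) ∧
      PreFrobenioid.IsOfType (PreFrobenioid.IsSubQuasiFrobeniusTrivial C₀.toElem) ∧
      ¬ PreFrobenioid.IsOfType (PreFrobenioid.IsGroupLikeObj C₀.toElem)) ∧
    ((ModelFrobenioid.data C₀.divisorMonoid C₀.ratFnFunctor C₀.divBNatTrans).IsOfStandardType ∧
      (PreFrobenioidData.ofFunctor C₀.divisorMonoid C₀.toElem).IsOfRationallyStandardType
        (PreFrobenioid.rsParams (C₀.isFrobenioid_treeCatVocab_of_isMonoidOn hBmon) fun a 𝔭 => PrimarySupp a 𝔭)) ∧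
    (∀ A : C₀.category, FrobenioidFacade.AutActionFactorsThrough (C₀.base ⋙ cnst) C₀.toElem A) ∧
    C₀.Thm37_iv :=
  C₀.thm37_ofRlfR_fin_of_inputs_of_cosetCnst hBmon hD hnd hrat h34 h₀ hfin hZQ hC.hcyc

end OfRlfR

end TemperedFrobenioid

end Literature.AnabelianGeometry.EtaleTheta
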